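import Summits.QuantumFields.YangMills.Theorems.GronwallGapContinuumFromLatticeGapOneFieldLocal
import Summits.QuantumFields.YangMills.Theorems.GronwallGapContinuumFromLatticeGapDockSWS
import HarnessLib

/-!
# `ContinuumFromLatticeGap` (stmt-QuantumFields-15915), line `registered`, reshape 5: the dock on `ScalingWindowSplit`
# over the LOCAL RP-spectral class (`stub_clayOfLocalInequalities`)

Support file for the crux item stmt-QuantumFields-15915 (`GronwallGap.ContinuumFromLatticeGap`).  The DEF-FREE rendering of
the reshape-5 skeleton `Cruxes/ContinuumFromLatticeGap/Lines/birth.lean`: the crux — and its sibling stmt-QuantumFields-15828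
`ContinuumLegGivenGap` — follow from `DirichletWindow.XiDiverges` (stmt-8941), the two registered open IR stubs INLINED as
hypotheses (ONE SCALE at the lock; LOCAL RP-spectral clustering at the lock — reshape 5 retires cold pressure at the lock,
refuted modulo `LightFluxMode` in `Theorems/ContinuumFromLatticeGap/Negative/ColdPressureAtLockVersusLatticeLeg.lean`, and
with it the GLOBAL slab class), and the FILED cruxes U_R (stmt-18014), W₂ᴳ `SelfNormalisedSkewnessGapped` (stmt-18170; the refuted W₂
stmt-18944 is no longer used), `CurvatureAmnesia` (stmt-16192) by name.  Chain: lock + criticality (landed) ⇒ scheme on locked data with `HasLatticeMassGap` ⇒ LOCAL RP-spectral clause at the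
lock ⇒ the LOCAL seam `oneField_of_latticeInequalities_local` ⇒ `hypercubicAt_of_oneField`, `concl_of_hypercubicAt`.
Registered anchor: `stub_clayOfLocalInequalities` (the dock's core: the Clay `G`-clause from the three lattice
inequalities at one witness over the local class).  No definitions, no named
facts.  Refs: GlimmJaffe1987 §6.1, §19.1; OsterwalderSeiler1978 §2.
-/

noncomputable section

namespace Summit.QuantumFields.YangMills.Theorems.ContinuumFromLatticeGap

open scoped SchwartzMap
open Filter Topology MeasureTheory
open Literature.MathematicalPhysics.QuantumFieldTheory Literature.MathematicalPhysics.QuantumLattice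
  Literature.MathematicalPhysics.AQFT Literature.Probability.LatticeModels
open Summit.QuantumFields.YangMills.Theses
open Summit.QuantumFields.YangMills.Theorems.ContinuumLegGivenGap
open Summit.QuantumFields.YangMills.Cruxes.HypercubicLimit.CouplingResponse (OneFieldClauses)

section Core

variable {G : Type} [Group G] [TopologicalSpace G] [IsTopologicalGroup G] [CompactSpace G]

/-- **The Clay `G`-clause from a locked critical datum, one scale, the LOCAL RP-spectral clause and the filed items**
(reshape 5: the common core of the two compositions below; twin of `concl_of_lockedDatum` with the RP-spectral clause
restricted to the LOCAL functional class and the seam `oneField_of_latticeInequalities_local`).  At a compact simple `G` (Borel σ-algebra) and a faithful `r`: a locked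
datum (`β_k → ∞`, rates `m̂_k`, UNIFORM with thresholds `S₁`) with `m̂ → 0`; one-scale data at it (unit `Δ₀ a_k ≤ m̂(φ k)`,
volumes `L_k ≥ S₁(φ k)` of polynomial growth, a past-supported bump `u` with floor ∧ window for every scheme on
`(a, β ∘ φ, L)`); the RP-spectral clause for every scheme pinned to the lock; U_R, W₂ and orientation amnesia by name.
Then the Clay `G`-clause. [cite: GlimmJaffe1987, §6.1 and §19.1] -/
theorem concl_of_lockedDatum_local (hG : IsCompactSimpleLieGroup G)
    (hU : ScalingWindowSplit.SelfNormalisedMomentBoundsR) (hW₂ : ScalingWindowSplit.SelfNormalisedSkewnessGapped)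
    (hA : CoincidenceRotationBootstrap.CurvatureAmnesia)
    (r : letI : MeasurableSpace G := borel G; LatticeRep G) (β mh : ℕ → ℝ) (S₁ : ℕ → ℕ)
    (hβ : Tendsto β atTop atTop)
    (hUNIF : letI : MeasurableSpace G := borel G; haveI : BorelSpace G := ⟨rfl⟩;
      ∀ A B : YMSpecies G, ∃ C : ℝ, ∀ k S n : ℕ, S₁ k ≤ S → n ≤ S →
        |latticeConnectedCorr r.ρ (β k) (2 * S + 1) A.F B.F n| ≤ C * Real.exp (-(mh k * n)))
    (hcrit : Tendsto mh atTop (𝓝 0))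
    (a : ℕ → ℝ) (φ : ℕ → ℕ) (Δ₀ : ℝ) (L : ℕ → ℕ) (u : 𝓢(EuclideanSpace ℝ (Fin 4), ℝ)) (p : ℕ) (M : ℝ)
    (ha : ∀ k, 0 < a k) (hφ : StrictMono φ) (hΔ₀ : 0 < Δ₀) (hpin : ∀ k, Δ₀ * a k ≤ mh (φ k))
    (hLS : ∀ k, S₁ (φ k) ≤ L k) (hpoly : ∃ N : ℕ, 1 ≤ N ∧ ∀ᶠ k in atTop, (a k)⁻¹ ≤ (a k * (L k : ℝ)) ^ N)
    (hu : tsupport u ⊆ {y : EuclideanSpace ℝ (Fin 4) | y 0 < 0})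
    (hfw : letI : MeasurableSpace G := borel G; haveI : BorelSpace G := ⟨rfl⟩;
      ∀ sch : SpeciesScheme (YMSpecies G), (∀ k, sch.a k = a k) → (∀ k, sch.β k = β (φ k)) →
        (∀ k, sch.L k = L k) →
        let bare : SpeciesScheme (YMSpecies G) := { sch with c := fun _ _ => 1, m := fun _ _ => 0 }
        let T : 𝓢(EuclideanSpace ℝ (Fin 4), ℝ) → ℕ → ℝ := fun w k =>
          latticeSchwinger r.ρ bare (fun s => s.F) k (1 + 1) (fun _ => r.curvature) ![w, thetaTest 4 w] -
            latticeSchwinger r.ρ bare (fun s => s.F) k 1 (fun _ => r.curvature) ![w] *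
              latticeSchwinger r.ρ bare (fun s => s.F) k 1 (fun _ => r.curvature) ![thetaTest 4 w]
        ∀ᶠ k in atTop, (sch.a k) ^ p ≤ T u k ∧ T u k ≤ M * T (timeShiftTest 4 (-1) u) k)
    (hRP : letI : MeasurableSpace G := borel G; haveI : BorelSpace G := ⟨rfl⟩;
      ∀ (sch : SpeciesScheme (YMSpecies G)) (φ : ℕ → ℕ) (Δ₀ : ℝ), StrictMono φ → 0 < Δ₀ →
        (∀ k, sch.β k = β (φ k)) → (∀ k, Δ₀ * sch.a k ≤ mh (φ k)) → (∀ k, S₁ (φ k) ≤ sch.L k) →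
        (∃ N : ℕ, 1 ≤ N ∧ ∀ᶠ k in atTop, (sch.a k)⁻¹ ≤ (sch.a k * (sch.L k : ℝ)) ^ N) →
        ∃ Δ C : ℝ, 0 < Δ ∧ Δ ≤ Δ₀ ∧
          (∀ᶠ k in atTop, ∀ (S₀ T₀ n R : ℕ), sch.L k ≤ S₀ → 2 * (T₀ + n + 1) ≤ S₀ → 2 * (R + 1) ≤ S₀ →
            ∀ (Y : LGConfig 4 G → ℝ) (B : ℝ), Measurable Y → (∀ U, |Y U| ≤ B) →
              DependsOn Y {e : Literature.MathematicalPhysics.QuantumLattice.ZdEdge 4 |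
                (1 ≤ e.1 0 ∧ e.1 0 + (if e.2 = 0 then 1 else 0) ≤ T₀) ∧ ∀ i : Fin 4, i ≠ 0 → |e.1 i| ≤ R} →
              |(∫ U, Y (torusLift (2 * S₀ + 1) (GaugeConfig.timeReflect U)) *
                    Y (configShift (-Pi.single 0 (n : ℤ)) (torusLift (2 * S₀ + 1) U))
                  ∂(wilsonMeasure r.ρ (sch.β k) : Measure (GaugeConfig 4 (2 * S₀ + 1) G))) -
                (∫ U, Y (torusLift (2 * S₀ + 1) U)
                  ∂(wilsonMeasure r.ρ (sch.β k) : Measure (GaugeConfig 4 (2 * S₀ + 1) G))) ^ 2| ≤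
                Real.exp (-(Δ * sch.a k * n)) *
                  ((∫ U, Y (torusLift (2 * S₀ + 1) (GaugeConfig.timeReflect U)) * Y (torusLift (2 * S₀ + 1) U)
                      ∂(wilsonMeasure r.ρ (sch.β k) : Measure (GaugeConfig 4 (2 * S₀ + 1) G))) -
                    (∫ U, Y (torusLift (2 * S₀ + 1) U)
                      ∂(wilsonMeasure r.ρ (sch.β k) : Measure (GaugeConfig 4 (2 * S₀ + 1) G))) ^ 2) +
                C * B ^ 2 * Real.exp (-(Δ * sch.a k * S₀)))) :
    letI : MeasurableSpace G := borel G
    haveI : BorelSpace G := ⟨rfl⟩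
    ∃ (r : LatticeRep G) (sch : SpeciesScheme (YMSpecies G)) (T : OSData (YMSpecies G) 4),
      sch.HasWeakCouplingLimit ∧ IsYangMillsFor r sch T ∧ T.IsNontrivial r.curvature ∧
        T.IsNonGaussian r.curvature ∧ ∃ Δ > 0, T.HasMassGap Δ ∧ HasLatticeMassGap r sch Δ := by
  letI : MeasurableSpace G := borel G
  haveI : BorelSpace G := ⟨rfl⟩
  obtain ⟨N, hN1, hpolyN⟩ := hpoly
  -- the scheme on the locked data
  have ha0 : Tendsto a atTop (𝓝 0) := stub_unitToZero a mh φ Δ₀ ha hφ hΔ₀ hpin hcrit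
  have hLt : Tendsto (fun k => a k * (L k : ℝ)) atTop atTop := cscl_tendsto_mul_of_pow hN1 ha ha0 hpolyN
  obtain ⟨sch, hsa, hsβ, hsL, -, -⟩ := stub_bareScheme G a (fun k => β (φ k)) L ha ha0 hLt
  have hw : sch.HasWeakCouplingLimit := by
    show Tendsto sch.β atTop atTop
    rw [show sch.β = fun k => β (φ k) from funext hsβ]
    exact hβ.comp hφ.tendsto_atTop
  have hpv : ∃ N : ℕ, 1 ≤ N ∧ ∀ᶠ k in atTop, (sch.a k)⁻¹ ≤ (sch.a k * (sch.L k : ℝ)) ^ N :=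
    ⟨N, hN1, hpolyN.mono fun k hk => by rw [hsa k, hsL k]; exact hk⟩
  have hpin' : ∀ k, Δ₀ * sch.a k ≤ mh (φ k) := fun k => by rw [hsa k]; exact hpin k
  have hLS' : ∀ k, S₁ (φ k) ≤ sch.L k := fun k => by rw [hsL k]; exact hLS k
  -- the lattice gap along the scheme and the RP-spectral clause
  have hGAP₀ : HasLatticeMassGap r sch Δ₀ := cclgSplit_gap_of_locked r hUNIF hsβ hpin' hLS'
  obtain ⟨Δ, C, hΔ, hΔle, hrp⟩ := hRP sch φ Δ₀ hφ hΔ₀ hsβ hpin' hLS' hpv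
  have hGAP : HasLatticeMassGap r sch Δ := cclgSplit_hasLatticeMassGap_mono r sch hΔle hGAP₀
  -- floor ∧ window at our scheme
  have hfw' := hfw sch hsa hsβ hsL
  -- the filed items U_R and W₂ at our scheme and bump, then the landed seam
  obtain ⟨sch', S₁', hw', h₁⟩ :=
    oneField_of_latticeInequalities_local r sch u p M Δ C
      hw hpv hΔ hGAP hrp hu hfw' (hU G r sch u p M hw hpv hu hfw') (hW₂ G r sch u p M Δ hw hΔ hGAP hpv hu hfw')
  -- one field ⇒ labelled witness at `G` ⇒ the Clay `G`-clause (amnesia by name, upgrade proved)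
  exact concl_of_hypercubicAt hA hG (hypercubicAt_of_oneField r sch' S₁' hw' h₁)

end Core

/-- **`continuumFromLatticeGap_of_scalingWindowSplit_local`** — the def-free RESHAPE-5 split of the crux
stmt-QuantumFields-15915: `XiDiverges → ⟨stub_oneScale⟩ → ⟨stub_rpSpectralLocalAtLock⟩ → SelfNormalisedMomentBoundsR →
SelfNormalisedSkewnessGapped → CurvatureAmnesia → GronwallGap.ContinuumFromLatticeGap` (W₂ re-docked on the repaired W₂ᴳ,
stmt-QuantumFields-18170, fed the lattice gap along our scheme — W₂ stmt-18944 was refuted 2026-08-17T11:39Z).  Reshape 5 retires cold pressure at the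
lock (refuted at every light-flux group modulo `LightFluxMode`, `Negative/ColdPressureAtLockVersusLatticeLeg`) together with
the GLOBAL RP-spectral class it produced, in favour of the LOCAL RP-spectral clause at the lock (`hRPL`, the registered
`stub_rpSpectralLocalAtLock` inlined).  One scale chooses `r`; the landed lock OFF the exceptional set (`stub_lockOffE`) and
criticality from the lock (`stub_criticalOfLock`) give the locked critical datum; then `concl_of_lockedDatum_local`.
[cite: GlimmJaffe1987, §6.1 and §19.1] -/
theorem continuumFromLatticeGap_of_scalingWindowSplit_local (hXi : DirichletWindow.XiDiverges)
    (hOne : ∀ (G : Type) [Group G] [TopologicalSpace G] [IsTopologicalGroup G] [CompactSpace G]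
      [MeasurableSpace G] [BorelSpace G], IsCompactSimpleLieGroup G → ∃ r : LatticeRep G,
      ∀ (β : ℕ → ℝ) (mh : ℕ → ℝ) (S₁ : ℕ → ℕ) (K : ℝ), Tendsto β atTop atTop → (∀ k, 0 < mh k) → 0 < K →
      (∀ A B : YMSpecies G, ∃ C : ℝ, ∀ k S n : ℕ, S₁ k ≤ S → n ≤ S →
        |latticeConnectedCorr r.ρ (β k) (2 * S + 1) A.F B.F n| ≤ C * Real.exp (-(mh k * n))) →
      (∀ k S₀ : ℕ, ∃ A B : YMSpecies G, ∀ C : ℝ, ∃ S n : ℕ, S₀ ≤ S ∧ n ≤ S ∧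
        C * Real.exp (-(K * mh k * n)) < |latticeConnectedCorr r.ρ (β k) (2 * S + 1) A.F B.F n|) →
      Tendsto mh atTop (𝓝 0) →
      ∃ (a : ℕ → ℝ) (φ : ℕ → ℕ) (Δ₀ : ℝ) (L : ℕ → ℕ) (u : 𝓢(EuclideanSpace ℝ (Fin 4), ℝ)) (p : ℕ) (M : ℝ),
        (∀ k, 0 < a k) ∧ StrictMono φ ∧ 0 < Δ₀ ∧ (∀ k, Δ₀ * a k ≤ mh (φ k)) ∧ (∀ k, S₁ (φ k) ≤ L k) ∧
        (∃ N : ℕ, 1 ≤ N ∧ ∀ᶠ k in atTop, (a k)⁻¹ ≤ (a k * (L k : ℝ)) ^ N) ∧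
        tsupport u ⊆ {y : EuclideanSpace ℝ (Fin 4) | y 0 < 0} ∧
        ∀ sch : SpeciesScheme (YMSpecies G), (∀ k, sch.a k = a k) → (∀ k, sch.β k = β (φ k)) →
          (∀ k, sch.L k = L k) →
          let bare : SpeciesScheme (YMSpecies G) := { sch with c := fun _ _ => 1, m := fun _ _ => 0 }
          let T : 𝓢(EuclideanSpace ℝ (Fin 4), ℝ) → ℕ → ℝ := fun w k =>
            latticeSchwinger r.ρ bare (fun s => s.F) k (1 + 1) (fun _ => r.curvature) ![w, thetaTest 4 w] -
              latticeSchwinger r.ρ bare (fun s => s.F) k 1 (fun _ => r.curvature) ![w] *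
                latticeSchwinger r.ρ bare (fun s => s.F) k 1 (fun _ => r.curvature) ![thetaTest 4 w]
          ∀ᶠ k in atTop, (sch.a k) ^ p ≤ T u k ∧ T u k ≤ M * T (timeShiftTest 4 (-1) u) k)
    (hRPL : ∀ (G : Type) [Group G] [TopologicalSpace G] [IsTopologicalGroup G] [CompactSpace G]
      [MeasurableSpace G] [BorelSpace G], IsCompactSimpleLieGroup G → ∀ (r : LatticeRep G)
      (β : ℕ → ℝ) (mh : ℕ → ℝ) (S₁ : ℕ → ℕ), Tendsto β atTop atTop → (∀ k, 0 < mh k) →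
      (∀ A B : YMSpecies G, ∃ C : ℝ, ∀ k S n : ℕ, S₁ k ≤ S → n ≤ S →
        |latticeConnectedCorr r.ρ (β k) (2 * S + 1) A.F B.F n| ≤ C * Real.exp (-(mh k * n))) →
      ∀ (sch : SpeciesScheme (YMSpecies G)) (φ : ℕ → ℕ) (Δ₀ : ℝ), StrictMono φ → 0 < Δ₀ →
        (∀ k, sch.β k = β (φ k)) → (∀ k, Δ₀ * sch.a k ≤ mh (φ k)) → (∀ k, S₁ (φ k) ≤ sch.L k) →
        (∃ N : ℕ, 1 ≤ N ∧ ∀ᶠ k in atTop, (sch.a k)⁻¹ ≤ (sch.a k * (sch.L k : ℝ)) ^ N) →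
        ∃ Δ C : ℝ, 0 < Δ ∧ Δ ≤ Δ₀ ∧
          (∀ᶠ k in atTop, ∀ (S₀ T₀ n R : ℕ), sch.L k ≤ S₀ → 2 * (T₀ + n + 1) ≤ S₀ → 2 * (R + 1) ≤ S₀ →
            ∀ (Y : LGConfig 4 G → ℝ) (B : ℝ), Measurable Y → (∀ U, |Y U| ≤ B) →
              DependsOn Y {e : Literature.MathematicalPhysics.QuantumLattice.ZdEdge 4 |
                (1 ≤ e.1 0 ∧ e.1 0 + (if e.2 = 0 then 1 else 0) ≤ T₀) ∧ ∀ i : Fin 4, i ≠ 0 → |e.1 i| ≤ R} →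
              |(∫ U, Y (torusLift (2 * S₀ + 1) (GaugeConfig.timeReflect U)) *
                    Y (configShift (-Pi.single 0 (n : ℤ)) (torusLift (2 * S₀ + 1) U))
                  ∂(wilsonMeasure r.ρ (sch.β k) : Measure (GaugeConfig 4 (2 * S₀ + 1) G))) -
                (∫ U, Y (torusLift (2 * S₀ + 1) U)
                  ∂(wilsonMeasure r.ρ (sch.β k) : Measure (GaugeConfig 4 (2 * S₀ + 1) G))) ^ 2| ≤
                Real.exp (-(Δ * sch.a k * n)) *
                  ((∫ U, Y (torusLift (2 * S₀ + 1) (GaugeConfig.timeReflect U)) * Y (torusLift (2 * S₀ + 1) U)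
                      ∂(wilsonMeasure r.ρ (sch.β k) : Measure (GaugeConfig 4 (2 * S₀ + 1) G))) -
                    (∫ U, Y (torusLift (2 * S₀ + 1) U)
                      ∂(wilsonMeasure r.ρ (sch.β k) : Measure (GaugeConfig 4 (2 * S₀ + 1) G))) ^ 2) +
                C * B ^ 2 * Real.exp (-(Δ * sch.a k * S₀))))
    (hU : ScalingWindowSplit.SelfNormalisedMomentBoundsR) (hW₂ : ScalingWindowSplit.SelfNormalisedSkewnessGapped)
    (hA : CoincidenceRotationBootstrap.CurvatureAmnesia) :
    GronwallGap.ContinuumFromLatticeGap := by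
  intro G _ _ _ _ hG hgap
  letI : MeasurableSpace G := borel G
  haveI : BorelSpace G := ⟨rfl⟩
  obtain ⟨r, hone⟩ := hOne G hG
  obtain ⟨β, mh, S₁, K, hβ, hmh, hK, hUNIF, hSHARP⟩ := stub_lockOffE hXi G hG r (hgap r)
  have hcrit : Tendsto mh atTop (𝓝 0) := stub_criticalOfLock hXi G hG r β mh S₁ hβ hmh hUNIF
  obtain ⟨a, φ, Δ₀, L, u, p, M, ha, hφ, hΔ₀, hpin, hLS, hpoly, hu, hfw⟩ :=
    hone β mh S₁ K hβ hmh hK hUNIF hSHARP hcrit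
  exact concl_of_lockedDatum_local hG hU hW₂ hA r β mh S₁ hβ hUNIF hcrit a φ Δ₀ L u p M ha hφ hΔ₀ hpin hLS hpoly
    hu hfw (fun sch φ' Δ₀' hφ' hΔ₀' hsβ hpin hLS hpv =>
      hRPL G hG r β mh S₁ hβ hmh hUNIF sch φ' Δ₀' hφ' hΔ₀' hsβ hpin hLS hpv)

/-- **`continuumLegGivenGap_of_scalingWindowSplit_local`** — the SAME reshape-5 dock closes the sibling crux
stmt-QuantumFields-15828 `ContinuumLegGivenGap` (hypothesis: gap at every `β ≥ β₀` with a pair-free threshold): the locked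
datum is the landed `cclgSplit_locked_of_core`, criticality is again `stub_criticalOfLock`; then `concl_of_lockedDatum_local`.
Stated for route `ComplexCouplingChannel`'s copy of the shared decl. [cite: GlimmJaffe1987, §6.1 and §19.1] -/
theorem continuumLegGivenGap_of_scalingWindowSplit_local (hXi : DirichletWindow.XiDiverges)
    (hOne : ∀ (G : Type) [Group G] [TopologicalSpace G] [IsTopologicalGroup G] [CompactSpace G]
      [MeasurableSpace G] [BorelSpace G], IsCompactSimpleLieGroup G → ∃ r : LatticeRep G,
      ∀ (β : ℕ → ℝ) (mh : ℕ → ℝ) (S₁ : ℕ → ℕ) (K : ℝ), Tendsto β atTop atTop → (∀ k, 0 < mh k) → 0 < K →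
      (∀ A B : YMSpecies G, ∃ C : ℝ, ∀ k S n : ℕ, S₁ k ≤ S → n ≤ S →
        |latticeConnectedCorr r.ρ (β k) (2 * S + 1) A.F B.F n| ≤ C * Real.exp (-(mh k * n))) →
      (∀ k S₀ : ℕ, ∃ A B : YMSpecies G, ∀ C : ℝ, ∃ S n : ℕ, S₀ ≤ S ∧ n ≤ S ∧
        C * Real.exp (-(K * mh k * n)) < |latticeConnectedCorr r.ρ (β k) (2 * S + 1) A.F B.F n|) →
      Tendsto mh atTop (𝓝 0) →
      ∃ (a : ℕ → ℝ) (φ : ℕ → ℕ) (Δ₀ : ℝ) (L : ℕ → ℕ) (u : 𝓢(EuclideanSpace ℝ (Fin 4), ℝ)) (p : ℕ) (M : ℝ),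
        (∀ k, 0 < a k) ∧ StrictMono φ ∧ 0 < Δ₀ ∧ (∀ k, Δ₀ * a k ≤ mh (φ k)) ∧ (∀ k, S₁ (φ k) ≤ L k) ∧
        (∃ N : ℕ, 1 ≤ N ∧ ∀ᶠ k in atTop, (a k)⁻¹ ≤ (a k * (L k : ℝ)) ^ N) ∧
        tsupport u ⊆ {y : EuclideanSpace ℝ (Fin 4) | y 0 < 0} ∧
        ∀ sch : SpeciesScheme (YMSpecies G), (∀ k, sch.a k = a k) → (∀ k, sch.β k = β (φ k)) →
          (∀ k, sch.L k = L k) →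
          let bare : SpeciesScheme (YMSpecies G) := { sch with c := fun _ _ => 1, m := fun _ _ => 0 }
          let T : 𝓢(EuclideanSpace ℝ (Fin 4), ℝ) → ℕ → ℝ := fun w k =>
            latticeSchwinger r.ρ bare (fun s => s.F) k (1 + 1) (fun _ => r.curvature) ![w, thetaTest 4 w] -
              latticeSchwinger r.ρ bare (fun s => s.F) k 1 (fun _ => r.curvature) ![w] *
                latticeSchwinger r.ρ bare (fun s => s.F) k 1 (fun _ => r.curvature) ![thetaTest 4 w]
          ∀ᶠ k in atTop, (sch.a k) ^ p ≤ T u k ∧ T u k ≤ M * T (timeShiftTest 4 (-1) u) k)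
    (hRPL : ∀ (G : Type) [Group G] [TopologicalSpace G] [IsTopologicalGroup G] [CompactSpace G]
      [MeasurableSpace G] [BorelSpace G], IsCompactSimpleLieGroup G → ∀ (r : LatticeRep G)
      (β : ℕ → ℝ) (mh : ℕ → ℝ) (S₁ : ℕ → ℕ), Tendsto β atTop atTop → (∀ k, 0 < mh k) →
      (∀ A B : YMSpecies G, ∃ C : ℝ, ∀ k S n : ℕ, S₁ k ≤ S → n ≤ S →
        |latticeConnectedCorr r.ρ (β k) (2 * S + 1) A.F B.F n| ≤ C * Real.exp (-(mh k * n))) →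
      ∀ (sch : SpeciesScheme (YMSpecies G)) (φ : ℕ → ℕ) (Δ₀ : ℝ), StrictMono φ → 0 < Δ₀ →
        (∀ k, sch.β k = β (φ k)) → (∀ k, Δ₀ * sch.a k ≤ mh (φ k)) → (∀ k, S₁ (φ k) ≤ sch.L k) →
        (∃ N : ℕ, 1 ≤ N ∧ ∀ᶠ k in atTop, (sch.a k)⁻¹ ≤ (sch.a k * (sch.L k : ℝ)) ^ N) →
        ∃ Δ C : ℝ, 0 < Δ ∧ Δ ≤ Δ₀ ∧
          (∀ᶠ k in atTop, ∀ (S₀ T₀ n R : ℕ), sch.L k ≤ S₀ → 2 * (T₀ + n + 1) ≤ S₀ → 2 * (R + 1) ≤ S₀ →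
            ∀ (Y : LGConfig 4 G → ℝ) (B : ℝ), Measurable Y → (∀ U, |Y U| ≤ B) →
              DependsOn Y {e : Literature.MathematicalPhysics.QuantumLattice.ZdEdge 4 |
                (1 ≤ e.1 0 ∧ e.1 0 + (if e.2 = 0 then 1 else 0) ≤ T₀) ∧ ∀ i : Fin 4, i ≠ 0 → |e.1 i| ≤ R} →
              |(∫ U, Y (torusLift (2 * S₀ + 1) (GaugeConfig.timeReflect U)) *
                    Y (configShift (-Pi.single 0 (n : ℤ)) (torusLift (2 * S₀ + 1) U))
                  ∂(wilsonMeasure r.ρ (sch.β k) : Measure (GaugeConfig 4 (2 * S₀ + 1) G))) -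
                (∫ U, Y (torusLift (2 * S₀ + 1) U)
                  ∂(wilsonMeasure r.ρ (sch.β k) : Measure (GaugeConfig 4 (2 * S₀ + 1) G))) ^ 2| ≤
                Real.exp (-(Δ * sch.a k * n)) *
                  ((∫ U, Y (torusLift (2 * S₀ + 1) (GaugeConfig.timeReflect U)) * Y (torusLift (2 * S₀ + 1) U)
                      ∂(wilsonMeasure r.ρ (sch.β k) : Measure (GaugeConfig 4 (2 * S₀ + 1) G))) -
                    (∫ U, Y (torusLift (2 * S₀ + 1) U)
                      ∂(wilsonMeasure r.ρ (sch.β k) : Measure (GaugeConfig 4 (2 * S₀ + 1) G))) ^ 2) +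
                C * B ^ 2 * Real.exp (-(Δ * sch.a k * S₀))))
    (hU : ScalingWindowSplit.SelfNormalisedMomentBoundsR) (hW₂ : ScalingWindowSplit.SelfNormalisedSkewnessGapped)
    (hA : CoincidenceRotationBootstrap.CurvatureAmnesia) :
    ComplexCouplingChannel.ContinuumLegGivenGap := by
  intro G _ _ _ _ hG hgap
  letI : MeasurableSpace G := borel G
  haveI : BorelSpace G := ⟨rfl⟩
  obtain ⟨r, hone⟩ := hOne G hG
  obtain ⟨β, mh, S₁, K, hβ, hmh, hK, hUNIF, hSHARP⟩ := cclgSplit_locked_of_core hXi hG r (hgap r)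
  have hcrit : Tendsto mh atTop (𝓝 0) := stub_criticalOfLock hXi G hG r β mh S₁ hβ hmh hUNIF
  obtain ⟨a, φ, Δ₀, L, u, p, M, ha, hφ, hΔ₀, hpin, hLS, hpoly, hu, hfw⟩ :=
    hone β mh S₁ K hβ hmh hK hUNIF hSHARP hcrit
  exact concl_of_lockedDatum_local hG hU hW₂ hA r β mh S₁ hβ hUNIF hcrit a φ Δ₀ L u p M ha hφ hΔ₀ hpin hLS hpoly
    hu hfw (fun sch φ' Δ₀' hφ' hΔ₀' hsβ hpin hLS hpv =>
      hRPL G hG r β mh S₁ hβ hmh hUNIF sch φ' Δ₀' hφ' hΔ₀' hsβ hpin hLS hpv)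


/-- **`stub_clayOfLocalInequalities`** (registered anchor of line `registered`, reshape 5 — the dock's core over a
general Borel measurable structure, `let`-free: the bare truncated two-point function `T` is a binder with its defining
equation, the bare scheme written with the constructor): **the Clay `G`-clause from the three lattice inequalities at ONE
witness over the LOCAL class** — a weak-coupling scheme with polynomial volumes, the uniform lattice gap at rate `Δ`, LOCAL
RP-spectral clustering at rate `Δ`, a past-supported bump with the polynomial floor and the window of `T`, plus U_R, W₂ᴳ
(fed the same gap) and orientation amnesia by name.  Proof: the measurable structure IS `borel G`, `T` IS the bare
truncated two-point function; the local seam `oneField_of_latticeInequalities_local`; `hypercubicAt_of_oneField`;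
`concl_of_hypercubicAt`. [cite: GlimmJaffe1987, §6.1 and §19.1] -/
theorem stub_clayOfLocalInequalities :
    ∀ (G : Type) [Group G] [TopologicalSpace G] [IsTopologicalGroup G] [CompactSpace G] [MeasurableSpace G]
      [BorelSpace G], IsCompactSimpleLieGroup G → ScalingWindowSplit.SelfNormalisedMomentBoundsR →
      ScalingWindowSplit.SelfNormalisedSkewnessGapped → CoincidenceRotationBootstrap.CurvatureAmnesia →
      ∀ (r : LatticeRep G) (sch : SpeciesScheme (YMSpecies G)) (u : 𝓢(EuclideanSpace ℝ (Fin 4), ℝ)) (p : ℕ) (M Δ C : ℝ)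
      (T : 𝓢(EuclideanSpace ℝ (Fin 4), ℝ) → ℕ → ℝ),
      (∀ w k, T w k = latticeSchwinger r.ρ (SpeciesScheme.mk sch.a sch.a_pos sch.tendsto_a sch.β sch.L sch.tendsto_L (fun _ _ => 1) (fun _ _ => 0))
          (fun s => s.F) k (1 + 1) (fun _ => r.curvature) ![w, thetaTest 4 w] -
        latticeSchwinger r.ρ (SpeciesScheme.mk sch.a sch.a_pos sch.tendsto_a sch.β sch.L sch.tendsto_L (fun _ _ => 1) (fun _ _ => 0))
          (fun s => s.F) k 1 (fun _ => r.curvature) ![w] *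
        latticeSchwinger r.ρ (SpeciesScheme.mk sch.a sch.a_pos sch.tendsto_a sch.β sch.L sch.tendsto_L (fun _ _ => 1) (fun _ _ => 0))
          (fun s => s.F) k 1 (fun _ => r.curvature) ![thetaTest 4 w]) →
      sch.HasWeakCouplingLimit → (∃ N : ℕ, 1 ≤ N ∧ ∀ᶠ k in atTop, (sch.a k)⁻¹ ≤ (sch.a k * (sch.L k : ℝ)) ^ N) →
      0 < Δ → HasLatticeMassGap r sch Δ →
      (∀ᶠ k in atTop, ∀ (S₀ T₀ n R : ℕ), sch.L k ≤ S₀ → 2 * (T₀ + n + 1) ≤ S₀ → 2 * (R + 1) ≤ S₀ →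
        ∀ (Y : LGConfig 4 G → ℝ) (B : ℝ), Measurable Y → (∀ U, |Y U| ≤ B) →
          DependsOn Y {e : Literature.MathematicalPhysics.QuantumLattice.ZdEdge 4 |
            (1 ≤ e.1 0 ∧ e.1 0 + (if e.2 = 0 then 1 else 0) ≤ T₀) ∧ ∀ i : Fin 4, i ≠ 0 → |e.1 i| ≤ R} →
          |(∫ U, Y (torusLift (2 * S₀ + 1) (GaugeConfig.timeReflect U)) *
                Y (configShift (-Pi.single 0 (n : ℤ)) (torusLift (2 * S₀ + 1) U))
              ∂(wilsonMeasure r.ρ (sch.β k) : Measure (GaugeConfig 4 (2 * S₀ + 1) G))) -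
            (∫ U, Y (torusLift (2 * S₀ + 1) U)
              ∂(wilsonMeasure r.ρ (sch.β k) : Measure (GaugeConfig 4 (2 * S₀ + 1) G))) ^ 2| ≤
            Real.exp (-(Δ * sch.a k * n)) *
              ((∫ U, Y (torusLift (2 * S₀ + 1) (GaugeConfig.timeReflect U)) * Y (torusLift (2 * S₀ + 1) U)
                  ∂(wilsonMeasure r.ρ (sch.β k) : Measure (GaugeConfig 4 (2 * S₀ + 1) G))) -
                (∫ U, Y (torusLift (2 * S₀ + 1) U)
                  ∂(wilsonMeasure r.ρ (sch.β k) : Measure (GaugeConfig 4 (2 * S₀ + 1) G))) ^ 2) +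
            C * B ^ 2 * Real.exp (-(Δ * sch.a k * S₀))) →
      tsupport u ⊆ {y : EuclideanSpace ℝ (Fin 4) | y 0 < 0} →
      (∀ᶠ k in atTop, (sch.a k) ^ p ≤ T u k ∧ T u k ≤ M * T (timeShiftTest 4 (-1) u) k) →
      ∃ (r : LatticeRep G) (sch : SpeciesScheme (YMSpecies G)) (T : OSData (YMSpecies G) 4),
        sch.HasWeakCouplingLimit ∧ IsYangMillsFor r sch T ∧ T.IsNontrivial r.curvature ∧
          T.IsNonGaussian r.curvature ∧ ∃ Δ > 0, T.HasMassGap Δ ∧ HasLatticeMassGap r sch Δ := by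
  intro G _ _ _ _ _ _ hG hU hW₂ hA r sch u p M Δ C T hT hw hpv hΔ hGAP hrp hu hfw
  obtain rfl : T = fun w k => latticeSchwinger r.ρ (SpeciesScheme.mk sch.a sch.a_pos sch.tendsto_a sch.β sch.L sch.tendsto_L (fun _ _ => 1) (fun _ _ => 0))
          (fun s => s.F) k (1 + 1) (fun _ => r.curvature) ![w, thetaTest 4 w] -
        latticeSchwinger r.ρ (SpeciesScheme.mk sch.a sch.a_pos sch.tendsto_a sch.β sch.L sch.tendsto_L (fun _ _ => 1) (fun _ _ => 0))
          (fun s => s.F) k 1 (fun _ => r.curvature) ![w] *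
        latticeSchwinger r.ρ (SpeciesScheme.mk sch.a sch.a_pos sch.tendsto_a sch.β sch.L sch.tendsto_L (fun _ _ => 1) (fun _ _ => 0))
          (fun s => s.F) k 1 (fun _ => r.curvature) ![thetaTest 4 w] := funext fun w => funext fun k => hT w k
  have hm : ‹MeasurableSpace G› = borel G := BorelSpace.measurable_eq
  subst hm
  letI : MeasurableSpace G := borel G
  haveI : BorelSpace G := ⟨rfl⟩
  obtain ⟨sch', S₁', hw', h₁⟩ :=
    oneField_of_latticeInequalities_local r sch u p M Δ C hw hpv hΔ hGAP hrp hu hfw (hU G r sch u p M hw hpv hu hfw)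
      (hW₂ G r sch u p M Δ hw hΔ hGAP hpv hu hfw)
  exact concl_of_hypercubicAt hA hG (hypercubicAt_of_oneField r sch' S₁' hw' h₁)

end Summit.QuantumFields.YangMills.Theorems.ContinuumFromLatticeGap

end
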